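import Summits.Parity.BatemanHorn.Theorems.SoloInformedSmoothHyperbolaFourier
import Literature.NumberTheory.Sieve.DivisorBound

/-!
# Window root equidistribution is a statement about the SMOOTH located count

Informed soloist `solo-Parity-informed` (session 142), conjunct `BatemanHorn`, the `d ≥ 3` rung BELOW the parity
wall; sequel to `SoloInformedSmoothHyperbola{,Fourier}`.

For irreducible `g` of degree `d ≥ 3` and any fixed `Δ > 0` the two elementary comparisons
* `Mid^w_g(x) − Mid_g(x) = O_{g,Δ}(x)` (`exists_abs_polySmoothMid_sub_located_le`): the two EXACT splits
  `S_g = 2Small + 2Mid + Sq − 2Bdry` and `S_g = 2Small^w + 2Mid^w` give `Mid^w − Mid = (Small − Small^w) + Sq/2 − Bdry`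
  (`polySmoothMid_sub_located_eq`), with `0 ≤ Small − Small^w ≤ ∑_{n≤x, |g(n)|<(xe^Δ)²} τ(|g(n)|) ≪ x^{11/12}`
  (`exists_sum_small_values_card_divisors_le`: `|g(n)| ≍ n^d`, `d ≥ 3`, `τ(m) ≪ m^{1/8}`), `Sq ≤ x`, `Bdry ≪ x`;
* `H^w_g(x; E) − H_g(x) = O_{g,Δ}(x)` (`exists_abs_polySmoothHeur_sub_le`): for each `n` both heuristics lie between
  `∑_{x<e≤e^{∓Δ}√|g(n)|} ρ(e)/e`, which differ by `2Δ·A_g + O_g(1)` (Dedekind–Landau, `L_g(⌊y⌋) = A_g log y + O(1)`),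
give THE REDUCTION (`windowRootEquidistribution_iff_smooth`):

  `WindowRootEquidistribution g ↔ (Mid^w_g(x) − H^w_g(x; E_g(x)))/(x log x) → 0`,

`E_g(x) = max_{n≤x} |g(n)|` (`polyEvalSup`).  The right side has the EXACT trilinear expansion in shifted Hooley
sums `S_{g(X+b)}(h; e)` of `SoloInformedSmoothHyperbolaFourier`: Erdős's asymptotic (open for irreducible `g` of
degree `≥ 3`) is first-order cancellation in that form.  Nothing here moves a wall row; verdict NO PATH unchanged.
-/

namespace Summit.Parity.BatemanHorn.Theorems

open Finset Polynomial Filter Topology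
open Literature.NumberTheory.Sieve (polyRootCountMod exists_sum_rootCount_le exists_card_divisors_le_mul_rpow)

/-- **Exact**: `Mid^w_g(x) − Mid_g(x) = (Small_g(x) − Small^w_g(x)) + Sq_g(x)/2 − Bdry_g(x)` (`g ≠ 0` on `[1,x]`,
`Δ ≠ 0`). [this work] -/
theorem polySmoothMid_sub_located_eq (g : ℤ[X]) {Δ : ℝ} (hΔ : Δ ≠ 0) {x : ℕ}
    (hg0 : ∀ n ∈ Icc 1 x, g.eval (n : ℤ) ≠ 0) :
    polySmoothMid g Δ x - polyLocatedRootCount g x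
      = ((polySmallStorey g x : ℝ) - polySmoothSmall g Δ x) + (polySqCount g x : ℝ) / 2 - polyBdryCount g x := by
  have h1 := polyDivisorSum_eq_two_mul_smooth g hΔ hg0
  have h2 : (polyDivisorSum g x : ℝ) + 2 * polyBdryCount g x
      = 2 * polySmallStorey g x + 2 * polyLocatedRootCount g x + polySqCount g x := by
    exact_mod_cast polyDivisorSum_add_two_mul_bdry_eq g x
  linarith

/-- `|Mid^w_g(x) − Mid_g(x)| ≤ ∑_{n≤x, |g(n)|<(xe^Δ)²} τ(|g(n)|) + x + Bdry_g(x)` (`g ≠ 0` on `[1,x]`, `Δ > 0`). [this work] -/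
theorem abs_polySmoothMid_sub_located_le (g : ℤ[X]) {Δ : ℝ} (hΔ : 0 < Δ) {x : ℕ}
    (hg0 : ∀ n ∈ Icc 1 x, g.eval (n : ℤ) ≠ 0) :
    |polySmoothMid g Δ x - polyLocatedRootCount g x|
      ≤ (∑ n ∈ (Icc 1 x).filter (fun n : ℕ => ((g.eval (n : ℤ)).natAbs : ℝ) < ((x : ℝ) * Real.exp Δ) ^ 2),
            (#(g.eval (n : ℤ)).natAbs.divisors : ℝ)) + x + polyBdryCount g x := by
  rw [polySmoothMid_sub_located_eq g hΔ.ne' hg0]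
  have h1 := polySmoothSmall_le g Δ x
  have h2 := polySmallStorey_sub_smooth_le g hΔ x
  have h3 : (polySqCount g x : ℝ) ≤ x := by exact_mod_cast polySqCount_le g x
  have h45 : (0 : ℝ) ≤ polySqCount g x ∧ (0 : ℝ) ≤ polyBdryCount g x := ⟨Nat.cast_nonneg _, Nat.cast_nonneg _⟩
  have h6 : (0 : ℝ) ≤ ∑ n ∈ (Icc 1 x).filter
      (fun n : ℕ => ((g.eval (n : ℤ)).natAbs : ℝ) < ((x : ℝ) * Real.exp Δ) ^ 2),
        (#(g.eval (n : ℤ)).natAbs.divisors : ℝ) := sum_nonneg fun _ _ => Nat.cast_nonneg _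
  rw [abs_le]
  constructor <;> linarith [h45.1, h45.2]

/-- **Few small values, few divisors each**: for `deg g ≥ 3` and `Δ > 0` there is `C` with
`∑_{n ≤ x, |g(n)| < (x e^Δ)²} τ(|g(n)|) ≤ C·x` for all `x ≥ 1` (indeed `≪ x^{2/3 + 1/4}`: `|g(n)| ≥ e^{−B} n^d` puts
such `n` below `e^{(2Δ+B)/3} x^{2/3}`, and `τ(m) ≤ C₁ m^{1/8}`). [this work] -/
theorem exists_sum_small_values_card_divisors_le {g : ℤ[X]} (hdeg : 3 ≤ g.natDegree) {Δ : ℝ} (hΔ : 0 < Δ) :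
    ∃ C : ℝ, ∀ x : ℕ, 1 ≤ x →
      ∑ n ∈ (Icc 1 x).filter (fun n : ℕ => ((g.eval (n : ℤ)).natAbs : ℝ) < ((x : ℝ) * Real.exp Δ) ^ 2),
          (#(g.eval (n : ℤ)).natAbs.divisors : ℝ) ≤ C * x := by
  obtain ⟨B, hB⟩ := exists_abs_log_natAbs_eval_sub_le (g := g) (by omega)
  obtain ⟨C₁, hC₁, hτ⟩ := exists_card_divisors_le_mul_rpow (by norm_num : (0 : ℝ) < 1 / 8)
  have hB0 : 0 ≤ B := le_trans (abs_nonneg _) (hB 1 le_rfl)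
  set K : ℝ := Real.exp ((2 * Δ + B) / 3) with hK
  refine ⟨K * (C₁ * Real.exp (Δ / 4)), fun x hx => ?_⟩
  have hx0 : (0 : ℝ) < x := by exact_mod_cast hx
  have hlogx : 0 ≤ Real.log (x : ℝ) := Real.log_nonneg (by exact_mod_cast hx)
  have hd3 : (3 : ℝ) ≤ g.natDegree := by exact_mod_cast hdeg
  set P : ℕ → Prop := fun n : ℕ => ((g.eval (n : ℤ)).natAbs : ℝ) < ((x : ℝ) * Real.exp Δ) ^ 2 with hP
  set Y : ℝ := K * Real.exp (2 / 3 * Real.log x) with hY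
  set M : ℝ := C₁ * Real.exp (Δ / 4) * Real.exp (1 / 4 * Real.log x) with hM
  have hM0 : 0 ≤ M := by positivity
  -- the logarithmic size bound for the small values
  have hlogN : ∀ n ∈ (Icc 1 x).filter P,
      Real.log ((g.eval (n : ℤ)).natAbs : ℝ) ≤ 2 * Real.log x + 2 * Δ := by
    intro n hn
    rw [mem_filter] at hn
    rcases Nat.eq_zero_or_pos (g.eval (n : ℤ)).natAbs with h0 | hpos
    · rw [h0, Nat.cast_zero, Real.log_zero]; positivity
    · have hNpos : (0 : ℝ) < ((g.eval (n : ℤ)).natAbs : ℝ) := by exact_mod_cast hpos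
      have h1 := Real.log_lt_log hNpos hn.2
      rw [Real.log_pow, Real.log_mul hx0.ne' (Real.exp_pos Δ).ne', Real.log_exp] at h1
      push_cast at h1
      linarith
  -- (i) every small-value `n` is `≤ Y`
  have hnY : ∀ n ∈ (Icc 1 x).filter P, (n : ℝ) ≤ Y := by
    intro n hn
    have hn1 : 1 ≤ n := (mem_Icc.mp (mem_filter.mp hn).1).1
    have hn0 : (0 : ℝ) < n := by exact_mod_cast hn1
    have hlogn : 0 ≤ Real.log (n : ℝ) := Real.log_nonneg (by exact_mod_cast hn1)
    have h1 := (abs_le.mp (hB n hn1)).1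
    have h2 := hlogN n hn
    have h3 : Real.log (n : ℝ) ≤ (2 * Δ + B) / 3 + 2 / 3 * Real.log x := by
      have : 3 * Real.log (n : ℝ) ≤ g.natDegree * Real.log n := by nlinarith
      linarith
    calc (n : ℝ) = Real.exp (Real.log n) := (Real.exp_log hn0).symm
      _ ≤ Real.exp ((2 * Δ + B) / 3 + 2 / 3 * Real.log x) := Real.exp_le_exp.mpr h3
      _ = Y := by rw [hY, hK, Real.exp_add]
  -- (ii) every small value has `≤ M` divisors
  have hτM : ∀ n ∈ (Icc 1 x).filter P, (#(g.eval (n : ℤ)).natAbs.divisors : ℝ) ≤ M := by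
    intro n hn
    rcases Nat.eq_zero_or_pos (g.eval (n : ℤ)).natAbs with h0 | hpos
    · rw [h0, Nat.divisors_zero, card_empty, Nat.cast_zero]; exact hM0
    · have hNpos : (0 : ℝ) < ((g.eval (n : ℤ)).natAbs : ℝ) := by exact_mod_cast hpos
      refine (hτ _ hpos.ne').trans ?_
      rw [Real.rpow_def_of_pos hNpos, hM, mul_assoc]
      refine mul_le_mul_of_nonneg_left ?_ (by linarith)
      rw [← Real.exp_add]
      refine Real.exp_le_exp.mpr ?_
      have := hlogN n hn
      nlinarith
  -- count × max
  have hcard : (#((Icc 1 x).filter P) : ℝ) ≤ Y := by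
    have hY0 : 0 ≤ Y := by positivity
    have hsub : (Icc 1 x).filter P ⊆ Icc 1 ⌊Y⌋₊ := by
      intro n hn
      have hn1 : 1 ≤ n := (mem_Icc.mp (mem_filter.mp hn).1).1
      exact mem_Icc.mpr ⟨hn1, Nat.le_floor (hnY n hn)⟩
    calc (#((Icc 1 x).filter P) : ℝ) ≤ #(Icc 1 ⌊Y⌋₊) := by exact_mod_cast card_le_card hsub
      _ = ⌊Y⌋₊ := by rw [Nat.card_Icc]; push_cast; ring
      _ ≤ Y := Nat.floor_le hY0
  calc ∑ n ∈ (Icc 1 x).filter P, (#(g.eval (n : ℤ)).natAbs.divisors : ℝ)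
      ≤ ∑ _n ∈ (Icc 1 x).filter P, M := sum_le_sum hτM
    _ = #((Icc 1 x).filter P) * M := by rw [sum_const, nsmul_eq_mul]
    _ ≤ Y * M := mul_le_mul_of_nonneg_right hcard hM0
    _ = K * (C₁ * Real.exp (Δ / 4)) * Real.exp ((2 / 3 + 1 / 4) * Real.log x) := by
        rw [hY, hM, add_mul, Real.exp_add]; ring
    _ ≤ K * (C₁ * Real.exp (Δ / 4)) * Real.exp (Real.log x) := by
        refine mul_le_mul_of_nonneg_left (Real.exp_le_exp.mpr ?_) (by positivity)
        nlinarith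
    _ = K * (C₁ * Real.exp (Δ / 4)) * x := by rw [Real.exp_log hx0]

/-- `Bdry_g(x) ≤ C·x` for `x ≥ 2`, `g` irreducible of degree `≥ 2` (`n² ≪ |g(n)|` and Hall–Tenenbaum). [this work] -/
theorem exists_polyBdryCount_le {g : ℤ[X]} (hirr : Irreducible g) (hdeg : 2 ≤ g.natDegree) :
    ∃ C : ℝ, ∀ x : ℕ, 2 ≤ x → (polyBdryCount g x : ℝ) ≤ C * x := by
  obtain ⟨B, hB, hsq⟩ := exists_sq_le_mul_natAbs_eval hdeg
    fun n _ => eval_natCast_ne_zero_of_irreducible hirr hdeg n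
  obtain ⟨C, hC0, hC⟩ := exists_sum_rootCount_le hirr (by omega)
  refine ⟨((B : ℝ) + 1) * C, fun x hx => ?_⟩
  have h1 := polyBdryCount_le_gen g (x := x) hB fun n hn => hsq n (mem_Icc.mp hn).1
  have h2 := hC (x : ℝ) (by exact_mod_cast hx)
  rw [Nat.floor_natCast] at h2
  calc (polyBdryCount g x : ℝ) ≤ ((B : ℝ) + 1) * ∑ d ∈ Icc 1 x, (polyRootCountMod ![g] d : ℝ) := h1
    _ ≤ ((B : ℝ) + 1) * (C * x) := mul_le_mul_of_nonneg_left h2 (by positivity)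
    _ = ((B : ℝ) + 1) * C * x := by ring

/-- **`Mid^w_g(x) − Mid_g(x) = O(x)`** for `g` irreducible of degree `≥ 3`, `Δ > 0`, `x ≥ 2`. [this work] -/
theorem exists_abs_polySmoothMid_sub_located_le {g : ℤ[X]} (hirr : Irreducible g) (hdeg : 3 ≤ g.natDegree)
    {Δ : ℝ} (hΔ : 0 < Δ) :
    ∃ C : ℝ, ∀ x : ℕ, 2 ≤ x → |polySmoothMid g Δ x - polyLocatedRootCount g x| ≤ C * x := by
  obtain ⟨C₁, hC₁⟩ := exists_sum_small_values_card_divisors_le hdeg hΔ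
  obtain ⟨C₂, hC₂⟩ := exists_polyBdryCount_le hirr (by omega)
  refine ⟨C₁ + 1 + C₂, fun x hx => ?_⟩
  have hg0 : ∀ n ∈ Icc 1 x, g.eval (n : ℤ) ≠ 0 :=
    fun n _ => eval_natCast_ne_zero_of_irreducible hirr (by omega) n
  have h := abs_polySmoothMid_sub_located_le g hΔ hg0
  have h1 := hC₁ x (by omega)
  have h2 := hC₂ x hx
  linarith

/-- `L_g` is monotone. [folklore] -/
theorem polySmallLevel_mono (g : ℤ[X]) {a b : ℕ} (hab : a ≤ b) : polySmallLevel g a ≤ polySmallLevel g b := by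
  unfold polySmallLevel
  exact sum_le_sum_of_subset_of_nonneg (Icc_subset_Icc le_rfl hab) fun _ _ _ => by positivity

/-- `L_g(0) = 0`. [folklore] -/
theorem polySmallLevel_zero (g : ℤ[X]) : polySmallLevel g 0 = 0 := by
  simp [polySmallLevel]

/-- `L(max x b) − L(max x a) ≤ L(b) − L(a)` for `a ≤ b` (monotonicity). [folklore] -/
theorem polySmallLevel_max_sub_max_le (g : ℤ[X]) (x : ℕ) {a b : ℕ} (hab : a ≤ b) :
    polySmallLevel g (max x b) - polySmallLevel g (max x a) ≤ polySmallLevel g b - polySmallLevel g a := by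
  rcases le_total x a with hxa | hxa
  · rw [max_eq_right hxa, max_eq_right (hxa.trans hab)]
  · rw [max_eq_left hxa]
    have h1 := polySmallLevel_mono g hxa
    rcases le_total x b with hxb | hxb
    · rw [max_eq_right hxb]; linarith
    · rw [max_eq_left hxb]
      have h2 := polySmallLevel_mono g hab
      linarith

/-- **The `e^{±Δ}` window around `√N` carries bounded CRT mass**: with `|L_g(⌊y⌋) − A log y| ≤ K₀` (`y ≥ 1`) and
`A > 0`, `L_g(⌊e^{Δ}√N⌋) − L_g(⌊e^{−Δ}√N⌋) ≤ 2K₀ + 2ΔA` for every `N ≥ 1`. [this work] -/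
theorem polySmallLevel_window_le (g : ℤ[X]) {A K₀ Δ : ℝ} (hA : 0 < A) (hΔ : 0 < Δ)
    (hK : ∀ y : ℝ, 1 ≤ y → |polySmallLevel g ⌊y⌋₊ - A * Real.log y| ≤ K₀) {N : ℕ} (hN : 1 ≤ N) :
    polySmallLevel g ⌊Real.exp Δ * Real.sqrt N⌋₊ - polySmallLevel g ⌊Real.exp (-Δ) * Real.sqrt N⌋₊
      ≤ 2 * K₀ + 2 * Δ * A := by
  have hK0 : 0 ≤ K₀ := le_trans (abs_nonneg _) (hK 1 le_rfl)
  have hNpos : (0 : ℝ) < N := by exact_mod_cast hN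
  have hs1 : 1 ≤ Real.sqrt N := by
    rw [← Real.sqrt_one]; exact Real.sqrt_le_sqrt (by exact_mod_cast hN)
  have hspos : 0 < Real.sqrt N := by linarith
  have hy₂ : 1 ≤ Real.exp Δ * Real.sqrt N :=
    one_le_mul_of_one_le_of_one_le (Real.one_le_exp hΔ.le) hs1
  have hlog₂ : Real.log (Real.exp Δ * Real.sqrt N) = Δ + Real.log (Real.sqrt N) := by
    rw [Real.log_mul (Real.exp_pos Δ).ne' hspos.ne', Real.log_exp]
  have hlog₁ : Real.log (Real.exp (-Δ) * Real.sqrt N) = -Δ + Real.log (Real.sqrt N) := by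
    rw [Real.log_mul (Real.exp_pos _).ne' hspos.ne', Real.log_exp]
  have h2 := (abs_le.mp (hK _ hy₂)).2
  rw [hlog₂] at h2
  rcases le_or_gt 1 (Real.exp (-Δ) * Real.sqrt N) with hy₁ | hy₁
  · have h1 := (abs_le.mp (hK _ hy₁)).1
    rw [hlog₁] at h1
    nlinarith
  · have hfl : ⌊Real.exp (-Δ) * Real.sqrt N⌋₊ = 0 := Nat.floor_eq_zero.mpr hy₁
    rw [hfl, polySmallLevel_zero, sub_zero]
    have hy₁pos : 0 < Real.exp (-Δ) * Real.sqrt N := by positivity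
    have hlogneg : Real.log (Real.exp (-Δ) * Real.sqrt N) < 0 := Real.log_neg hy₁pos hy₁
    rw [hlog₁] at hlogneg
    nlinarith

/-- **`H^w_g(x; E) − H_g(x) = O(x)`**: for `g` irreducible of degree `≥ 2` and `Δ > 0` there is `K` with
`|H^w_g(x; E) − H_g(x)| ≤ K·x` for all `x` and all `E ≥ max_{n≤x}|g(n)|`. [this work] -/
theorem exists_abs_polySmoothHeur_sub_le {g : ℤ[X]} (hirr : Irreducible g) (hdeg : 2 ≤ g.natDegree)
    {Δ : ℝ} (hΔ : 0 < Δ) :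
    ∃ K : ℝ, ∀ x E : ℕ, (∀ n ∈ Icc 1 x, (g.eval (n : ℤ)).natAbs ≤ E) →
      |polySmoothHeur g Δ x E - polyLocatedHeuristic g x| ≤ K * x := by
  obtain ⟨K₀, hK₀⟩ := exists_abs_polySmallLevel_natFloor_sub_le hirr (by omega)
  have hA := rootLevelConst_pos hirr (by omega)
  refine ⟨2 * K₀ + 2 * Δ * rootLevelConst g, fun x E hE => ?_⟩
  have hg0 : ∀ n ∈ Icc 1 x, g.eval (n : ℤ) ≠ 0 :=
    fun n _ => eval_natCast_ne_zero_of_irreducible hirr hdeg n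
  -- both heuristics as sums over `n`
  have hHw : polySmoothHeur g Δ x E
      = ∑ n ∈ Icc 1 x, ∑ e ∈ Ioc x E, (polyRootCountMod ![g] e : ℝ) / e * locWeight g Δ e n := by
    unfold polySmoothHeur
    rw [sum_comm]
    exact sum_congr rfl fun e _ => by rw [mul_sum]
  rw [hHw, polyLocatedHeuristic, ← sum_sub_distrib]
  refine (abs_sum_le_sum_abs _ _).trans ?_
  have hx : ((∑ _n ∈ Icc 1 x, (2 * K₀ + 2 * Δ * rootLevelConst g) : ℝ))
      = (2 * K₀ + 2 * Δ * rootLevelConst g) * x := by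
    rw [sum_const, Nat.card_Icc, nsmul_eq_mul]; push_cast; ring
  rw [← hx]
  refine sum_le_sum fun n hn => ?_
  -- the window for this `n`
  set N : ℕ := (g.eval (n : ℤ)).natAbs with hNdef
  have hN1 : 1 ≤ N := Nat.one_le_iff_ne_zero.mpr (Int.natAbs_ne_zero.mpr (hg0 n hn))
  have hNE : N ≤ E := hE n hn
  have hNpos : (0 : ℝ) < N := by exact_mod_cast hN1
  set y₁ : ℝ := Real.exp (-Δ) * Real.sqrt N with hy₁
  set y₂ : ℝ := Real.exp Δ * Real.sqrt N with hy₂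
  set a : ℕ := ⌊y₁⌋₊ with ha
  set b : ℕ := ⌊y₂⌋₊ with hb
  have hsqrtN : Real.sqrt N ≤ N := by
    have h1 : (1 : ℝ) ≤ N := by exact_mod_cast hN1
    calc Real.sqrt N ≤ Real.sqrt ((N : ℝ) ^ 2) := Real.sqrt_le_sqrt (by nlinarith)
      _ = N := Real.sqrt_sq hNpos.le
  have hy₁le : y₁ ≤ Real.sqrt N := by
    have : Real.exp (-Δ) ≤ 1 := Real.exp_le_one_iff.mpr (by linarith)
    calc y₁ ≤ 1 * Real.sqrt N := mul_le_mul_of_nonneg_right this (Real.sqrt_nonneg _)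
      _ = Real.sqrt N := one_mul _
  have hley₂ : Real.sqrt N ≤ y₂ := by
    calc Real.sqrt N = 1 * Real.sqrt N := (one_mul _).symm
      _ ≤ y₂ := mul_le_mul_of_nonneg_right (Real.one_le_exp hΔ.le) (Real.sqrt_nonneg _)
  have haE : a ≤ E := Nat.floor_le_of_le (hy₁le.trans (hsqrtN.trans (by exact_mod_cast hNE)))
  have has : a ≤ Nat.sqrt N := by
    rw [← Real.nat_floor_real_sqrt_eq_nat_sqrt]; exact Nat.floor_le_floor hy₁le
  have hsb : Nat.sqrt N ≤ b := by
    rw [← Real.nat_floor_real_sqrt_eq_nat_sqrt]; exact Nat.floor_le_floor hley₂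
  have hnonneg : ∀ i ∈ Ioc x b, 0 ≤ (polyRootCountMod ![g] i : ℝ) / i := fun _ _ => by positivity
  -- the weight is `1` up to `a` and `0` beyond `b`
  have hone : ∀ e ∈ Ioc x a, locWeight g Δ e n = 1 := by
    intro e he
    rw [mem_Ioc] at he
    have he1 : 1 ≤ e := by omega
    refine locWeight_eq_one g hΔ he1 ?_
    have h1 : (e : ℝ) ≤ y₁ := le_trans (by exact_mod_cast he.2) (Nat.floor_le (by positivity))
    have h2 : (e : ℝ) * Real.exp Δ ≤ Real.sqrt N := by
      calc (e : ℝ) * Real.exp Δ ≤ y₁ * Real.exp Δ := mul_le_mul_of_nonneg_right h1 (Real.exp_pos Δ).le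
        _ = Real.sqrt N := by
          rw [hy₁, mul_assoc, mul_comm (Real.sqrt N), ← mul_assoc, ← Real.exp_add, neg_add_cancel,
            Real.exp_zero, one_mul]
    calc ((e : ℝ) * Real.exp Δ) ^ 2 ≤ (Real.sqrt N) ^ 2 := pow_le_pow_left₀ (by positivity) h2 2
      _ = N := Real.sq_sqrt hNpos.le
  have hzero : ∀ e ∈ Ioc x E, ¬ e ≤ b → locWeight g Δ e n = 0 := by
    intro e _ heb
    refine locWeight_eq_zero g hΔ (hg0 n hn) ?_
    have h1 : y₂ < e := Nat.lt_of_floor_lt (by omega)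
    have h2 : y₂ ^ 2 ≤ (e : ℝ) ^ 2 := pow_le_pow_left₀ (by positivity) h1.le 2
    calc (N : ℝ) * (Real.exp Δ) ^ 2 = y₂ ^ 2 := by rw [hy₂, mul_pow, Real.sq_sqrt hNpos.le]; ring
      _ ≤ (e : ℝ) ^ 2 := h2
  -- lower and upper bounds for the smooth window
  have hlo : ∑ e ∈ Ioc x a, (polyRootCountMod ![g] e : ℝ) / e
      ≤ ∑ e ∈ Ioc x E, (polyRootCountMod ![g] e : ℝ) / e * locWeight g Δ e n := by
    calc ∑ e ∈ Ioc x a, (polyRootCountMod ![g] e : ℝ) / e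
        = ∑ e ∈ Ioc x a, (polyRootCountMod ![g] e : ℝ) / e * locWeight g Δ e n :=
          sum_congr rfl fun e he => by rw [hone e he, mul_one]
      _ ≤ _ := sum_le_sum_of_subset_of_nonneg (Ioc_subset_Ioc le_rfl haE) fun e _ _ =>
          mul_nonneg (by positivity) (locWeight_nonneg _ _ _ _)
  have hhi : ∑ e ∈ Ioc x E, (polyRootCountMod ![g] e : ℝ) / e * locWeight g Δ e n
      ≤ ∑ e ∈ Ioc x b, (polyRootCountMod ![g] e : ℝ) / e := by
    calc ∑ e ∈ Ioc x E, (polyRootCountMod ![g] e : ℝ) / e * locWeight g Δ e n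
        = ∑ e ∈ Ioc x E, if e ≤ b then (polyRootCountMod ![g] e : ℝ) / e * locWeight g Δ e n else 0 := by
          refine sum_congr rfl fun e he => ?_
          split_ifs with heb
          · rfl
          · rw [hzero e he heb, mul_zero]
      _ = ∑ e ∈ (Ioc x E).filter (fun e => e ≤ b), (polyRootCountMod ![g] e : ℝ) / e * locWeight g Δ e n :=
          (sum_filter _ _).symm
      _ ≤ ∑ e ∈ (Ioc x E).filter (fun e => e ≤ b), (polyRootCountMod ![g] e : ℝ) / e :=
          sum_le_sum fun e _ => mul_le_of_le_one_right (by positivity) (locWeight_le_one _ _ _ _)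
      _ ≤ ∑ e ∈ Ioc x b, (polyRootCountMod ![g] e : ℝ) / e := by
          refine sum_le_sum_of_subset_of_nonneg ?_ fun e he _ => hnonneg e he
          intro e he
          rw [mem_filter, mem_Ioc] at he
          rw [mem_Ioc]
          exact ⟨he.1.1, he.2⟩
  have hlo' := sum_le_sum_of_subset_of_nonneg (f := fun e => (polyRootCountMod ![g] e : ℝ) / e)
    (Ioc_subset_Ioc (le_refl x) has) fun e _ _ => by positivity
  have hhi' := sum_le_sum_of_subset_of_nonneg (f := fun e => (polyRootCountMod ![g] e : ℝ) / e)
    (Ioc_subset_Ioc (le_refl x) hsb) fun e he _ => hnonneg e he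
  -- the window mass
  have hwin : ∑ e ∈ Ioc x b, (polyRootCountMod ![g] e : ℝ) / e - ∑ e ∈ Ioc x a, (polyRootCountMod ![g] e : ℝ) / e
      ≤ 2 * K₀ + 2 * Δ * rootLevelConst g := by
    rw [sum_Ioc_rootCount_div_eq_level_sub, sum_Ioc_rootCount_div_eq_level_sub]
    have hab : a ≤ b := has.trans hsb
    have h1 := polySmallLevel_max_sub_max_le g x hab
    have h2 := polySmallLevel_window_le g hA hΔ hK₀ hN1
    rw [← ha, ← hb] at h2
    linarith
  rw [abs_le]
  constructor <;> linarith

/-- `E_g(x) = max_{1≤n≤x} |g(n)|`. [this work] -/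
def polyEvalSup (g : ℤ[X]) (x : ℕ) : ℕ :=
  (Icc 1 x).sup fun n => (g.eval (n : ℤ)).natAbs

/-- `|g(n)| ≤ E_g(x)` for `1 ≤ n ≤ x`. [folklore] -/
theorem natAbs_eval_le_polyEvalSup (g : ℤ[X]) {x n : ℕ} (hn : n ∈ Icc 1 x) :
    (g.eval (n : ℤ)).natAbs ≤ polyEvalSup g x := by
  unfold polyEvalSup
  exact Finset.le_sup (f := fun m : ℕ => (g.eval (m : ℤ)).natAbs) hn

/-- **THE REDUCTION.**  For `g` irreducible of degree `≥ 3` and any `Δ > 0`, and any admissible choice of the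
outer range `E(x) ≥ max_{n≤x}|g(n)|`:
`WindowRootEquidistribution g ↔ (Mid^w_g(x) − H^w_g(x; E(x)))/(x log x) → 0`.
The right side is the normalised EXACT trilinear form in shifted Hooley sums of
`SoloInformedSmoothHyperbolaFourier.polySmoothMid_sub_heur_eq_shift`. [this work] -/
theorem windowRootEquidistribution_iff_smooth_of {g : ℤ[X]} (hirr : Irreducible g) (hdeg : 3 ≤ g.natDegree)
    {Δ : ℝ} (hΔ : 0 < Δ) {E : ℕ → ℕ} (hE : ∀ x : ℕ, ∀ n ∈ Icc 1 x, (g.eval (n : ℤ)).natAbs ≤ E x) :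
    WindowRootEquidistribution g ↔
      Tendsto (fun x : ℕ => (polySmoothMid g Δ x - polySmoothHeur g Δ x (E x)) / ((x : ℝ) * Real.log x))
        atTop (𝓝 0) := by
  obtain ⟨C₁, hC₁⟩ := exists_abs_polySmoothMid_sub_located_le hirr hdeg hΔ
  obtain ⟨C₂, hC₂⟩ := exists_abs_polySmoothHeur_sub_le hirr (by omega) hΔ
  set u : ℕ → ℝ := fun x => (polySmoothMid g Δ x - polySmoothHeur g Δ x (E x))
    - ((polyLocatedRootCount g x : ℝ) - polyLocatedHeuristic g x) with hu
  have hu_le : ∀ x : ℕ, 2 ≤ x → |u x| ≤ (C₁ + C₂) * x := by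
    intro x hx
    have h1 := hC₁ x hx
    have h2 := hC₂ x (E x) (hE x)
    have hsplit : u x = (polySmoothMid g Δ x - polyLocatedRootCount g x)
        - (polySmoothHeur g Δ x (E x) - polyLocatedHeuristic g x) := by rw [hu]; ring
    rw [hsplit]
    refine (abs_sub _ _).trans ?_
    linarith
  have h0 := tendsto_div_mul_log_of_abs_le hu_le
  unfold WindowRootEquidistribution
  constructor
  · intro h
    have h1 := h.add h0
    rw [add_zero] at h1
    refine h1.congr fun x => ?_
    rw [hu, ← add_div]
    ring
  · intro h
    have h1 := h.sub h0
    rw [sub_zero] at h1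
    refine h1.congr fun x => ?_
    rw [hu, ← sub_div]
    ring

/-- **THE REDUCTION, canonical outer range** `E_g(x) = max_{n≤x}|g(n)|`. [this work] -/
theorem windowRootEquidistribution_iff_smooth {g : ℤ[X]} (hirr : Irreducible g) (hdeg : 3 ≤ g.natDegree)
    {Δ : ℝ} (hΔ : 0 < Δ) :
    WindowRootEquidistribution g ↔
      Tendsto (fun x : ℕ => (polySmoothMid g Δ x - polySmoothHeur g Δ x (polyEvalSup g x))
        / ((x : ℝ) * Real.log x)) atTop (𝓝 0) :=
  windowRootEquidistribution_iff_smooth_of hirr hdeg hΔ fun _ _ hn => natAbs_eval_le_polyEvalSup g hn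

/-- **Erdős ⟺ smooth located cancellation** (`g` irreducible, `deg g ≥ 3`, `Δ > 0`):
`S_g(x) ~ d·A_g·x log x ↔ (Mid^w_g(x) − H^w_g(x; E_g(x)))/(x log x) → 0`. [this work] -/
theorem erdosDivisorSumAsymptotic_iff_smooth {g : ℤ[X]} (hirr : Irreducible g) (hdeg : 3 ≤ g.natDegree)
    {Δ : ℝ} (hΔ : 0 < Δ) :
    ErdosDivisorSumAsymptotic g ↔
      Tendsto (fun x : ℕ => (polySmoothMid g Δ x - polySmoothHeur g Δ x (polyEvalSup g x))
        / ((x : ℝ) * Real.log x)) atTop (𝓝 0) := by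
  rw [← windowRootEquidistribution_iff_smooth hirr hdeg hΔ]
  exact erdosDivisorSumAsymptotic_iff_windowRootEquidistribution hirr (by omega)

end Summit.Parity.BatemanHorn.Theorems
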